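import Mathlib
import Literature.Analysis.FluidPDE.NSSerrinRegularityProofs
import Summits.NavierStokesRegularity.NavierStokesRegularity.Theorems.StretchingWellBindingEnstrophyQuarterLawSparseSieveDefs
import Summits.NavierStokesRegularity.NavierStokesRegularity.Theorems.StretchingWellBindingEnstrophyQuarterLawSparsenessTools
import HarnessLib

/-!
# Shelf crux `EnstrophyQuarterLaw` (stmt-NavierStokesRegularity-1574), line «sparse_sieve»:
# UNIFORM SPARSENESS (stub S2) FROM A MULTI-SCAR ENVELOPE OF ARBITRARY RATE — S2 is blind to the blow-up type

Helper file (`--supports stmt-NavierStokesRegularity-1574`) for the OPEN registered stub `stub_uniformSparseness` (S2; predicate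
`SparseSieve.UniformSparseness`, p817378). MAIN RESULT (`uniformSparseness_of_envelope`, unconditional real analysis): if a
family of slices `u(t)`, `t ∈ [0,T)`, has energy `∫|u(t)|² ≤ E` and obeys a MULTI-SCAR ENVELOPE

  `|u(t,x)| ≤ C' + Σ_{a ∈ σ} C' / (‖x − a‖ + ℓ(t))`   (`σ` a finite set of scars, `ℓ(t) > 0` ANY positive function),

then `UniformSparseness T u` holds: for every `ε₀` some `N₀(ε₀)` bounds, at every time and every scale `0 < r ≤ 1`, the number
of `4r`-separated balls `B(x,2r)` carrying `∫|u(t)|³ ≥ ε₀³`. The rate `ℓ(t)` — `√(T−t)` for Type I, anything smaller for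
Type II — is NEVER USED beyond `ℓ > 0`: balls far from the scars (`dist(x,σ) ≥ (D+2)r`, `D = D(ε₀)`) see `|u| ≤ C' + |σ|C'/(Dr)`,
hence carry `< ε₀³` at fine scales `r ≤ r₁(ε₀)` and are counted by the energy at coarse scales (`card·ε₀³ ≤ 8·sup|u|·E`,
`card_mul_le_of_norm_le_on_balls`); balls near a scar are counted by volume packing (`≤ |σ|((D+4)/2)³`,
`SparsenessTools.card_filter_mem_ball_le_of_separated`).

* `card_mul_le_of_norm_le_on_balls` / `card_le_of_norm_le_on_balls` — energy count for families whose balls see `|v| ≤ U`;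
* `envelope_le_on_far_ball` — the envelope is `≤ C' + |σ|·C'/(Dr)` on a ball `B(x,2r)` with `dist(x,a) ≥ (D+2)r` for all scars;
* `lintegral_far_ball_le` — hence `∫_{B(x,2r)} |u(t)|³ ≤ 8|B₁|·(C'r + |σ|C'/D)³` there;
* `uniformSparseness_of_envelope` — the main result (abstract slices);
* `uniformSparseness_of_envelope_lerayHopf` — the same along a Leray–Hopf solution on `[0,T]` (energy and measurability from
  `IsLerayHopfOn`): ANY first blow-up with a multi-scar envelope of ANY rate satisfies the registered stub S2's conclusion.

READING (census currency, shelf 1574). The census reads `EQL ⟺ 0056 ∧ S2∀` (p817733) with 0056 = sup-rate Type I. This file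
shows the second factor is TYPE-BLIND: S2 is implied by "finitely many scars, no satellites" envelopes at every rate, Type II
included (a single collapsing bubble `|u| ≲ 1/(‖x−a‖ + ℓ(t))`, `ℓ(t) ≪ √(T−t)`, satisfies S2). So S2∀'s enemy is MULTIPLICITY
(satellite swarms / infinitely many scars), not the rate; in TIQG's vocabulary, `ScarEnvelopeTypeI`'s conclusion (stmt-23843,
`ℓ = √(T−t)`) gives S2 by this file, independently of the `LorentzUpgradeTypeI` (24108) chain. HONEST FRAMING: real analysis
about HYPOTHETICAL envelopes; S2, `EnstrophyQuarterLaw` (1574), 0056 and Navier–Stokes regularity stay OPEN; no summit statement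
is proved.
-/

noncomputable section

-- the summit and its single sub-problem share the name (CONVENTIONS §1), as in every Theorems file
set_option linter.dupNamespace false

namespace Summit.NavierStokesRegularity.NavierStokesRegularity.Theorems.EnstrophyQuarterLaw.EnvelopeSparseness

open MeasureTheory Set Metric Filter Topology Module
open Literature.Analysis Literature.Analysis.FluidPDE
open scoped ENNReal NNReal

/-! ### Energy count for families whose balls see a sup bound -/

/-- **`card · ε₀³ ≤ 8 U ∫ |v|²`** for a `4r`-separated family whose balls `B(x,2r)` carry `∫‖v‖³ ≥ ε₀³` and on which
`‖v‖ ≤ U` (the bound is only needed ON the balls). [folklore] -/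
theorem card_mul_le_of_norm_le_on_balls {v : EuclideanSpace ℝ (Fin 3) → EuclideanSpace ℝ (Fin 3)}
    (hv : AEStronglyMeasurable v volume) {U r ε₀ : ℝ} (hr : 0 < r)
    (F : Finset (EuclideanSpace ℝ (Fin 3)))
    (hsep : ∀ x ∈ F, ∀ y ∈ F, x ≠ y → 4 * r ≤ dist x y)
    (hbd : ∀ x ∈ F, ∀ y ∈ ball x (2 * r), ‖v y‖ ≤ U)
    (hconc : ∀ x ∈ F, ENNReal.ofReal (ε₀ ^ 3) ≤ ∫⁻ y in ball x (2 * r), ‖v y‖ₑ ^ 3) :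
    (F.card : ℝ≥0∞) * ENNReal.ofReal (ε₀ ^ 3) ≤
      ENNReal.ofReal 8 * ENNReal.ofReal U * ∫⁻ y, ‖v y‖ₑ ^ 2 := by
  have hg : AEMeasurable (fun y => ‖v y‖ₑ ^ 2) volume := hv.enorm.pow_const 2
  have hball : ∀ x ∈ F, ENNReal.ofReal (ε₀ ^ 3) ≤
      ENNReal.ofReal U * ∫⁻ y in ball x (2 * r), ‖v y‖ₑ ^ 2 := by
    intro x hx
    refine (hconc x hx).trans ?_
    calc ∫⁻ y in ball x (2 * r), ‖v y‖ₑ ^ 3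
        ≤ ∫⁻ y in ball x (2 * r), ENNReal.ofReal U * ‖v y‖ₑ ^ 2 := by
          refine setLIntegral_mono' measurableSet_ball fun y hy => ?_
          rw [pow_succ', ← ofReal_norm]
          exact mul_le_mul' (ENNReal.ofReal_le_ofReal (hbd x hx y hy)) le_rfl
      _ = ENNReal.ofReal U * ∫⁻ y in ball x (2 * r), ‖v y‖ₑ ^ 2 :=
          lintegral_const_mul'' _ hg.restrict
  have hover := SparsenessTools.sum_setLIntegral_ball_le_of_separated (s := 4 * r) (ρ := 2 * r)
    (by positivity) (by positivity) F hsep hg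
  have h8 : ENNReal.ofReal (((2 * r + 4 * r / 2) / (4 * r / 2)) ^ 3) = ENNReal.ofReal 8 := by
    congr 1; field_simp; norm_num
  rw [h8] at hover
  calc (F.card : ℝ≥0∞) * ENNReal.ofReal (ε₀ ^ 3) = ∑ x ∈ F, ENNReal.ofReal (ε₀ ^ 3) := by
        rw [Finset.sum_const, nsmul_eq_mul]
    _ ≤ ∑ x ∈ F, ENNReal.ofReal U * ∫⁻ y in ball x (2 * r), ‖v y‖ₑ ^ 2 := Finset.sum_le_sum hball
    _ = ENNReal.ofReal U * ∑ x ∈ F, ∫⁻ y in ball x (2 * r), ‖v y‖ₑ ^ 2 := by rw [Finset.mul_sum]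
    _ ≤ ENNReal.ofReal U * (ENNReal.ofReal 8 * ∫⁻ y, ‖v y‖ₑ ^ 2) := mul_le_mul' le_rfl hover
    _ = ENNReal.ofReal 8 * ENNReal.ofReal U * ∫⁻ y, ‖v y‖ₑ ^ 2 := by ring

/-- **Real form: `card ≤ 8 U E / ε₀³`** under `‖v‖ ≤ U` on the balls (`0 ≤ U`), `∫‖v‖² ≤ E` (`0 ≤ E`), `ε₀ > 0`. [folklore] -/
theorem card_le_of_norm_le_on_balls {v : EuclideanSpace ℝ (Fin 3) → EuclideanSpace ℝ (Fin 3)}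
    (hv : AEStronglyMeasurable v volume) {U : ℝ} (hU : 0 ≤ U) {E : ℝ} (hE : 0 ≤ E)
    (hEn : ∫⁻ y, ‖v y‖ₑ ^ 2 ≤ ENNReal.ofReal E) {r ε₀ : ℝ} (hr : 0 < r) (hε₀ : 0 < ε₀)
    (F : Finset (EuclideanSpace ℝ (Fin 3)))
    (hsep : ∀ x ∈ F, ∀ y ∈ F, x ≠ y → 4 * r ≤ dist x y)
    (hbd : ∀ x ∈ F, ∀ y ∈ ball x (2 * r), ‖v y‖ ≤ U)
    (hconc : ∀ x ∈ F, ENNReal.ofReal (ε₀ ^ 3) ≤ ∫⁻ y in ball x (2 * r), ‖v y‖ₑ ^ 3) :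
    (F.card : ℝ) ≤ 8 * U * E / ε₀ ^ 3 := by
  have h := (card_mul_le_of_norm_le_on_balls hv hr F hsep hbd hconc).trans (mul_le_mul' le_rfl hEn)
  rw [← ENNReal.ofReal_mul (by norm_num), ← ENNReal.ofReal_mul (by positivity), ← ENNReal.ofReal_natCast,
    ← ENNReal.ofReal_mul (Nat.cast_nonneg _), ENNReal.ofReal_le_ofReal_iff (by positivity)] at h
  rw [le_div_iff₀ (by positivity)]
  exact h

/-! ### The envelope far from the scars -/

/-- **The envelope on a ball far from every scar.** If `dist(x, a) ≥ (D+2)r` for all `a ∈ σ` (`C' ≥ 0`, `ℓ, D, r > 0`),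
then for `y ∈ B(x, 2r)`: `C' + Σ_{a∈σ} C'/(‖y−a‖ + ℓ) ≤ C' + |σ|·C'/(Dr)`. [folklore] -/
theorem envelope_le_on_far_ball {σ : Finset (EuclideanSpace ℝ (Fin 3))} {C' ℓ D r : ℝ} (hC' : 0 ≤ C')
    (hℓ : 0 < ℓ) (hD : 0 < D) (hr : 0 < r) {x y : EuclideanSpace ℝ (Fin 3)}
    (hfar : ∀ a ∈ σ, (D + 2) * r ≤ dist x a) (hy : y ∈ ball x (2 * r)) :
    C' + ∑ a ∈ σ, C' / (‖y - a‖ + ℓ) ≤ C' + σ.card * (C' / (D * r)) := by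
  have hterm : ∀ a ∈ σ, C' / (‖y - a‖ + ℓ) ≤ C' / (D * r) := by
    intro a ha
    have hxa := hfar a ha
    have hxy : dist y x < 2 * r := mem_ball.1 hy
    have hya : D * r ≤ ‖y - a‖ := by
      rw [← dist_eq_norm]
      have := dist_triangle x y a
      rw [dist_comm x y] at this
      nlinarith
    exact div_le_div_of_nonneg_left hC' (by positivity) (by linarith)
  have hsum : ∑ a ∈ σ, C' / (‖y - a‖ + ℓ) ≤ ∑ a ∈ σ, C' / (D * r) := Finset.sum_le_sum hterm
  rw [Finset.sum_const, nsmul_eq_mul] at hsum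
  linarith

/-- **`L³` mass of a far ball under the envelope**: with `V₁ = |B(0,1)|`, if `‖w y‖ ≤ C' + Σ_{a∈σ} C'/(‖y−a‖+ℓ)` for all `y`
and `dist(x,a) ≥ (D+2)r` for all `a ∈ σ`, then `∫_{B(x,2r)} ‖w‖³ ≤ 8·V₁·(C'r + |σ|C'/D)³`. [folklore] -/
theorem lintegral_far_ball_le {σ : Finset (EuclideanSpace ℝ (Fin 3))} {C' ℓ D r : ℝ} (hC' : 0 ≤ C')
    (hℓ : 0 < ℓ) (hD : 0 < D) (hr : 0 < r) {w : EuclideanSpace ℝ (Fin 3) → EuclideanSpace ℝ (Fin 3)}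
    (henv : ∀ y, ‖w y‖ ≤ C' + ∑ a ∈ σ, C' / (‖y - a‖ + ℓ)) {x : EuclideanSpace ℝ (Fin 3)}
    (hfar : ∀ a ∈ σ, (D + 2) * r ≤ dist x a) :
    ∫⁻ y in ball x (2 * r), ‖w y‖ₑ ^ 3 ≤
      ENNReal.ofReal (8 * (C' * r + σ.card * C' / D) ^ 3) *
        volume (ball (0 : EuclideanSpace ℝ (Fin 3)) 1) := by
  set M : ℝ := C' + σ.card * (C' / (D * r)) with hM
  have hM0 : 0 ≤ M := by positivity
  have hpt : ∀ y ∈ ball x (2 * r), ‖w y‖ₑ ^ 3 ≤ ENNReal.ofReal (M ^ 3) := by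
    intro y hy
    have h1 : ‖w y‖ ≤ M := (henv y).trans (envelope_le_on_far_ball hC' hℓ hD hr hfar hy)
    rw [← ofReal_norm, ← ENNReal.ofReal_pow (norm_nonneg _)]
    exact ENNReal.ofReal_le_ofReal (pow_le_pow_left₀ (norm_nonneg _) h1 3)
  have hvol : volume (ball x (2 * r)) =
      ENNReal.ofReal (8 * r ^ 3) * volume (ball (0 : EuclideanSpace ℝ (Fin 3)) 1) := by
    rw [Measure.addHaar_ball_of_pos _ _ (by positivity : (0 : ℝ) < 2 * r), finrank_euclideanSpace_fin,
      show (2 * r) ^ 3 = 8 * r ^ 3 by ring]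
  calc ∫⁻ y in ball x (2 * r), ‖w y‖ₑ ^ 3
      ≤ ∫⁻ _ in ball x (2 * r), ENNReal.ofReal (M ^ 3) := setLIntegral_mono' measurableSet_ball hpt
    _ = ENNReal.ofReal (M ^ 3) * (ENNReal.ofReal (8 * r ^ 3) * volume (ball (0 : EuclideanSpace ℝ (Fin 3)) 1)) := by
        rw [setLIntegral_const, hvol]
    _ = ENNReal.ofReal (8 * (C' * r + σ.card * C' / D) ^ 3) * volume (ball (0 : EuclideanSpace ℝ (Fin 3)) 1) := by
        rw [← mul_assoc, ← ENNReal.ofReal_mul (by positivity)]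
        congr 2
        rw [hM]
        field_simp

/-! ### The main result -/

/-- **UNIFORM SPARSENESS FROM A MULTI-SCAR ENVELOPE OF ARBITRARY RATE.** Let `u(t)`, `t ∈ [0,T)`, be a.e.-strongly
measurable slices with `∫‖u(t)‖² ≤ E` and `‖u(t,x)‖ ≤ C' + Σ_{a∈σ} C'/(‖x − a‖ + ℓ(t))` for a finite set `σ ⊆ ℝ³`, constants
`C', E ≥ 0` and ANY positive function `ℓ` on `[0,T)`. Then `UniformSparseness T u` (the registered stub-S2 predicate, p817378):
with `r₀ = 1`, for every `ε₀ > 0` there is `N₀` such that at every `t ∈ [0,T)` and every scale `0 < r ≤ 1`, every `4r`-separated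
family of centres whose balls `B(x,2r)` carry `∫‖u(t)‖³ ≥ ε₀³` has at most `N₀` members
(`N₀ = ⌈|σ|((D+4)/2)³ + 8U₂E/ε₀³⌉`, `D = 2(8|B₁|+1)(|σ|C'+1)/ε₀`, `r₁ = ε₀/(2(8|B₁|+1)(C'+1))`, `U₂ = C' + |σ|C'/(Dr₁)`).
[folklore] -/
theorem uniformSparseness_of_envelope {T : ℝ}
    {u : ℝ → EuclideanSpace ℝ (Fin 3) → EuclideanSpace ℝ (Fin 3)}
    (σ : Finset (EuclideanSpace ℝ (Fin 3))) {C' E : ℝ} (hC' : 0 ≤ C') (hE : 0 ≤ E) (ℓ : ℝ → ℝ)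
    (hℓ : ∀ t ∈ Ico 0 T, 0 < ℓ t)
    (hmeas : ∀ t ∈ Ico 0 T, AEStronglyMeasurable (u t) volume)
    (hEn : ∀ t ∈ Ico 0 T, ∫⁻ y, ‖u t y‖ₑ ^ 2 ≤ ENNReal.ofReal E)
    (henv : ∀ t ∈ Ico 0 T, ∀ x, ‖u t x‖ ≤ C' + ∑ a ∈ σ, C' / (‖x - a‖ + ℓ t)) :
    SparseSieve.UniformSparseness T u := by
  classical
  -- absolute and `ε₀`-dependent constants
  set V₁ : ℝ≥0∞ := volume (ball (0 : EuclideanSpace ℝ (Fin 3)) 1) with hV₁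
  have hV₁top : V₁ ≠ ⊤ := measure_ball_lt_top.ne
  set V : ℝ := 8 * V₁.toReal with hV
  have hV0 : 0 ≤ V := by positivity
  set k : ℝ := (σ.card : ℝ) with hk
  have hk0 : 0 ≤ k := Nat.cast_nonneg _
  refine ⟨1, one_pos, fun ε₀ hε₀ => ?_⟩
  set D : ℝ := 2 * (V + 1) * (k * C' + 1) / ε₀ with hD
  have hDpos : 0 < D := by positivity
  set r₁ : ℝ := ε₀ / (2 * (V + 1) * (C' + 1)) with hr₁
  have hr₁pos : 0 < r₁ := by positivity
  set U₂ : ℝ := C' + k * (C' / (D * r₁)) with hU₂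
  have hU₂0 : 0 ≤ U₂ := by positivity
  set Nnear : ℝ := k * ((D + 4) / 2) ^ 3 with hNnear
  set Nfar : ℝ := 8 * U₂ * E / ε₀ ^ 3 with hNfar
  have hNnear0 : 0 ≤ Nnear := by positivity
  have hNfar0 : 0 ≤ Nfar := by positivity
  refine ⟨⌈Nnear + Nfar⌉₊, fun t ht r hr F hsep hconc => ?_⟩
  have hr0 : 0 < r := hr.1
  have hℓt := hℓ t ht
  -- split the family into near-scar and far-from-scars centres
  set P : EuclideanSpace ℝ (Fin 3) → Prop := fun x => ∃ a ∈ σ, dist x a < (D + 2) * r with hP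
  set Fnear := F.filter P with hFnear
  set Ffar := F.filter (fun x => ¬ P x) with hFfar
  have hsplit : F.card = Fnear.card + Ffar.card := (Finset.card_filter_add_card_filter_not P).symm
  have hfar_mem : ∀ x ∈ Ffar, ∀ a ∈ σ, (D + 2) * r ≤ dist x a := by
    intro x hx a ha
    have hnP : ¬ P x := (Finset.mem_filter.1 hx).2
    by_contra hlt
    exact hnP ⟨a, ha, not_le.1 hlt⟩
  -- NEAR: volume packing around each scar
  have hnear : (Fnear.card : ℝ) ≤ Nnear := by
    have hsub : Fnear ⊆ σ.biUnion (fun a => F.filter (fun x => a ∈ ball x ((D + 2) * r))) := by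
      intro x hx
      obtain ⟨hxF, a, ha, hxa⟩ := Finset.mem_filter.1 hx
      rw [Finset.mem_biUnion]
      refine ⟨a, ha, Finset.mem_filter.2 ⟨hxF, ?_⟩⟩
      rw [mem_ball, dist_comm]; exact hxa
    have h1 : (Fnear.card : ℝ) ≤ ∑ a ∈ σ, ((F.filter (fun x => a ∈ ball x ((D + 2) * r))).card : ℝ) := by
      have := (Finset.card_le_card hsub).trans Finset.card_biUnion_le
      exact_mod_cast this
    have h2 : ∀ a ∈ σ, ((F.filter (fun x => a ∈ ball x ((D + 2) * r))).card : ℝ) ≤ ((D + 4) / 2) ^ 3 := by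
      intro a _
      have h := SparsenessTools.card_filter_mem_ball_le_of_separated (s := 4 * r) (ρ := (D + 2) * r)
        (by positivity) (by positivity) F hsep a
      have he : ((D + 2) * r + 4 * r / 2) / (4 * r / 2) = (D + 4) / 2 := by
        field_simp; ring
      rwa [he] at h
    calc (Fnear.card : ℝ) ≤ ∑ a ∈ σ, ((F.filter (fun x => a ∈ ball x ((D + 2) * r))).card : ℝ) := h1
      _ ≤ ∑ a ∈ σ, ((D + 4) / 2) ^ 3 := Finset.sum_le_sum h2
      _ = Nnear := by rw [Finset.sum_const, nsmul_eq_mul]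
  -- FAR: empty at fine scales, energy-counted at coarse scales
  have hfar : (Ffar.card : ℝ) ≤ Nfar := by
    by_cases hfine : r ≤ r₁
    · -- fine scales: no far ball concentrates
      have hempty : Ffar = ∅ := by
        rw [Finset.eq_empty_iff_forall_notMem]
        intro x hx
        have hxF : x ∈ F := (Finset.mem_filter.1 hx).1
        have hle := lintegral_far_ball_le hC' hℓt hDpos hr0 (henv t ht) (hfar_mem x hx)
        have hlt : ENNReal.ofReal (8 * (C' * r + σ.card * C' / D) ^ 3) * V₁ < ENNReal.ofReal (ε₀ ^ 3) := by
          rw [← ENNReal.ofReal_toReal hV₁top, ← ENNReal.ofReal_mul (by positivity),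
            ENNReal.ofReal_lt_ofReal_iff (by positivity)]
          -- `C' r ≤ ε₀/(2(V+1))` and `k C'/D ≤ ε₀/(2(V+1))`
          have hq1 : C' * r ≤ ε₀ / (2 * (V + 1)) := by
            calc C' * r ≤ C' * r₁ := mul_le_mul_of_nonneg_left hfine hC'
              _ = ε₀ / (2 * (V + 1)) * (C' / (C' + 1)) := by rw [hr₁]; field_simp
              _ ≤ ε₀ / (2 * (V + 1)) * 1 := by
                  refine mul_le_mul_of_nonneg_left ?_ (by positivity)
                  rw [div_le_one (by positivity)]; linarith
              _ = ε₀ / (2 * (V + 1)) := mul_one _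
          have hq2 : (σ.card : ℝ) * C' / D ≤ ε₀ / (2 * (V + 1)) := by
            rw [← hk, hD]
            calc k * C' / (2 * (V + 1) * (k * C' + 1) / ε₀)
                = ε₀ / (2 * (V + 1)) * (k * C' / (k * C' + 1)) := by field_simp
              _ ≤ ε₀ / (2 * (V + 1)) * 1 := by
                  refine mul_le_mul_of_nonneg_left ?_ (by positivity)
                  rw [div_le_one (by positivity)]; linarith
              _ = ε₀ / (2 * (V + 1)) := mul_one _
          have hq : C' * r + σ.card * C' / D ≤ ε₀ / (V + 1) := by
            have : ε₀ / (2 * (V + 1)) + ε₀ / (2 * (V + 1)) = ε₀ / (V + 1) := by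
              field_simp; ring
            linarith
          have hq0 : 0 ≤ C' * r + σ.card * C' / D := by positivity
          calc 8 * (C' * r + σ.card * C' / D) ^ 3 * V₁.toReal
              = V * (C' * r + σ.card * C' / D) ^ 3 := by rw [hV]; ring
            _ ≤ V * (ε₀ / (V + 1)) ^ 3 := mul_le_mul_of_nonneg_left (pow_le_pow_left₀ hq0 hq 3) hV0
            _ = ε₀ ^ 3 * (V / (V + 1) ^ 3) := by field_simp
            _ < ε₀ ^ 3 * 1 := by
                refine mul_lt_mul_of_pos_left ?_ (by positivity)
                rw [div_lt_one (by positivity)]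
                have h1 : V + 1 ≤ (V + 1) ^ 3 := le_self_pow₀ (by linarith) (by norm_num)
                linarith
            _ = ε₀ ^ 3 := mul_one _
        exact absurd (hconc x hxF) (not_le.2 (lt_of_le_of_lt hle hlt))
      rw [hempty, Finset.card_empty, Nat.cast_zero]
      exact hNfar0
    · -- coarse scales `r₁ < r`: the far balls see `‖u‖ ≤ U₂`; count by energy
      have hr₁r : r₁ ≤ r := (not_le.1 hfine).le
      have hsepfar : ∀ x ∈ Ffar, ∀ y ∈ Ffar, x ≠ y → 4 * r ≤ dist x y := fun x hx y hy hxy =>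
        hsep x (Finset.mem_filter.1 hx).1 y (Finset.mem_filter.1 hy).1 hxy
      have hconcfar : ∀ x ∈ Ffar, ENNReal.ofReal (ε₀ ^ 3) ≤ ∫⁻ y in ball x (2 * r), ‖u t y‖ₑ ^ 3 :=
        fun x hx => hconc x (Finset.mem_filter.1 hx).1
      have hbd : ∀ x ∈ Ffar, ∀ y ∈ ball x (2 * r), ‖u t y‖ ≤ U₂ := by
        intro x hx y hy
        refine (henv t ht y).trans ((envelope_le_on_far_ball hC' hℓt hDpos hr0 (hfar_mem x hx) hy).trans ?_)
        rw [hU₂, ← hk]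
        have : C' / (D * r) ≤ C' / (D * r₁) :=
          div_le_div_of_nonneg_left hC' (by positivity) (mul_le_mul_of_nonneg_left hr₁r hDpos.le)
        nlinarith [hk0]
      have h := card_le_of_norm_le_on_balls (hmeas t ht) hU₂0 hE (hEn t ht) hr0 hε₀ Ffar hsepfar hbd hconcfar
      rw [hNfar]; exact h
  -- assemble
  have htot : (F.card : ℝ) ≤ Nnear + Nfar := by
    rw [hsplit, Nat.cast_add]; exact add_le_add hnear hfar
  have hceil : Nnear + Nfar ≤ (⌈Nnear + Nfar⌉₊ : ℝ) := Nat.le_ceil _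
  exact_mod_cast htot.trans hceil

/-- **Along a Leray–Hopf solution** (energy inequality `∫|u(t)|² ≤ 2E(u₀)`, measurable slices): a multi-scar envelope of
ANY positive rate `ℓ(t)` on `[0,T)` gives `UniformSparseness T u` — the conclusion of the registered stub S2
(`stub_uniformSparseness`) for that solution, whatever the type of a blow-up at `T`. [folklore] -/
theorem uniformSparseness_of_envelope_lerayHopf {ν T : ℝ}
    {u : ℝ → EuclideanSpace ℝ (Fin 3) → EuclideanSpace ℝ (Fin 3)} (hν : 0 < ν)
    (hLH : IsLerayHopfOn T ν 0 (u 0) u)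
    (σ : Finset (EuclideanSpace ℝ (Fin 3))) {C' : ℝ} (hC' : 0 ≤ C') (ℓ : ℝ → ℝ)
    (hℓ : ∀ t ∈ Ico 0 T, 0 < ℓ t)
    (henv : ∀ t ∈ Ico 0 T, ∀ x, ‖u t x‖ ≤ C' + ∑ a ∈ σ, C' / (‖x - a‖ + ℓ t)) :
    SparseSieve.UniformSparseness T u := by
  have hE₀ : 0 ≤ VectorCalculus.kineticEnergy (u 0) := by
    rw [VectorCalculus.kineticEnergy]
    exact mul_nonneg (by norm_num) (integral_nonneg fun _ => by positivity)
  refine uniformSparseness_of_envelope σ hC' (by positivity : (0 : ℝ) ≤ 2 * VectorCalculus.kineticEnergy (u 0))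
    ℓ hℓ (fun t ht => (hLH.memLp t ⟨ht.1, ht.2.le⟩).aestronglyMeasurable)
    (fun t ht => hLH.eEnergy_le_datum hν.le ⟨ht.1, ht.2.le⟩) henv

end Summit.NavierStokesRegularity.NavierStokesRegularity.Theorems.EnstrophyQuarterLaw.EnvelopeSparseness

end
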